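import Summits.BirchSwinnertonDyer.BirchSwinnertonDyer.Theorems.AlignedTransportAtTwoMainConjectureOfRankZeroBSDAtTwoLayerValueDoublyDark
import HarnessLib

/-!
# Route `AlignedTransportAtTwo`, crux C2 `MainConjectureOfRankZeroBSDAtTwo` (stmt-BirchSwinnertonDyer-22298):
# THE TWIN TABLE AT `λ = 2` — for an `ι`-stable `F ∈ ℤ₂⟦T⟧` with `μ(F) = 0`, `λ(F) = 2` the pair `(ord₂ F(0), ord₂ F(−2))` is `(1,1)`, `(2, ≥3)`
# or `(≥3, 2)`; so the twin door is EXACT on the weight-`≥3` cell as well: `(μ, λ) = (0, 2) ⟺ ord₂ f_X(−2) = 2` (e.g. the `a₂ = −1` anchors, weight `4`)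

HONEST FRAMING (cell `bsd-f1-sign2`, WIDTH-5 attached prover seat `bsd-line-att-p5` gen 50 on line `birth` of the lead
`bsd-line-att-p2`; `--supports` stmt-BirchSwinnertonDyer-22298, closes nothing; BSD is NOT proved by any of this; the crux C2, its
verdict «blocked-on `Rank1Residual.GreenbergMuConjectureIrreducible`» and every registered stub are untouched). THEOREMS ONLY — no `def`, no
instance, no named fact, no `sorry`. Completes the siblings `…LayerValueDoublyDark` (`T² + qT + q`; `(2,2)` excludes `λ = 2`) and `…LayerValueTwinExact`
(weight `2`: `(μ,λ) = (0,2) ⟺` twin `≥ 3`).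

THE POINT. With `P = T² + qT + q` the distinguished polynomial (`q ∈ 2ℤ₂`) and units `v₀, v₂`: `F(0) = q·v₀`, `F(−2) = (4 − q)·v₂`. Reading `ord₂`:
`v(q) = 1 ⟹ v(4 − q) = 1`; `v(q) = 2 ⟹ 8 ∣ 4 − q`; `v(q) ≥ 3 ⟹ v(4 − q) = 2`. Hence
* ★★★ `twin_table_of_lam_eq_two` (divisibility form): `ι`-stable, `μ = 0`, `λ = 2` ⟹ **`(2 ∥ F(0) ∧ 2 ∥ F(−2)) ∨ (4 ∥ F(0) ∧ 8 ∣ F(−2)) ∨ (8 ∣ F(0) ∧ 4 ∥ F(−2))`**;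
* ★★ `valuation_evalAt_eq_two_of_three_le`: `ord₂ F(0) ≥ 3`, `F(−2) ≠ 0` ⟹ `ord₂ F(−2) = 2`;
* ★★★ `mu_eq_zero_and_lam_eq_two_iff_twin_eq_two` (Λ-level): for `ι`-stable `F` with `ord₂ F(0) ≥ 3` and `F(−2) ≠ 0`: **`μ = 0 ∧ λ = 2 ⟺ ord₂ F(−2) = 2`**
  (⟸ g49's `lam_eq_two_of_twinValue`; ⟹ the table);
* ★★★ `mu_eq_zero_and_lambda_eq_two_iff_twin_eq_two` (C2 datum, Euler weight `w ≥ 3`, PRINT `h114`): **`μ(X) = 0 ∧ λ(X) = 2 ⟺ ord₂ f_X(−2) = 2`** — on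
  the weight-`4` habitat (`a₂ = −1`, or `Ш(W)[2] = (ℤ/2)²`) g49's «twin-two» door is exactly the `(0, 2)` locus (census: the 12 matched weight-4 LIT anchors
  all have `λ_an = 2`; memo `Cruxes/MainConjectureOfRankZeroBSDAtTwo/LAYER-VALUE-att-p5-g50.md`).
BSD is not proved by any of this.

References: R. Greenberg, LNM 1716 (1999), Thm. 1.14, Thm. 4.1, §5 p. 181 [GreenbergLNM1716]; L. Washington, GTM 83, §7.1 [Washington1997];
B. Mazur, J. Tate, J. Teitelbaum, Invent. Math. 84 (1986) Ch. I §17 [MazurTateTeitelbaum1986Invent].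
-/

set_option linter.dupNamespace false
set_option autoImplicit false

noncomputable section

open scoped Classical MatrixGroups ModularForm

namespace Summit.BirchSwinnertonDyer.BirchSwinnertonDyer.Theorems.AlignedTransportAtTwoLayerValueTwinTable

open PowerSeries CongruenceSubgroup WeierstrassCurve Literature.NumberTheory.EllipticCurves
  Literature.NumberTheory.EllipticCurves.IwasawaAlgebra
  Literature.NumberTheory.EllipticCurves.ModularForms
  Literature.NumberTheory.EllipticCurves.Rank1Residual
  Literature.NumberTheory.EllipticCurves.Rank1Residual.Typed
  Literature.NumberTheory.EllipticCurves.Greenberg1999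
  Summit.BirchSwinnertonDyer.Rank1Residual
  Summit.BirchSwinnertonDyer.Rank1Residual.X1.MuLambda
  Summit.BirchSwinnertonDyer.Rank1Residual.X1.MuPart
  Summit.BirchSwinnertonDyer.Rank1Residual.X1.ParitySqueeze
  Summit.BirchSwinnertonDyer.Rank1Residual.X5
  Summit.BirchSwinnertonDyer.Rank1Residual.F1Sign2
  Summit.BirchSwinnertonDyer.Rank1Residual.Iwasawa
  Summit.BirchSwinnertonDyer.Rank1Residual.Supersingular
  Summit.BirchSwinnertonDyer.Rank1Residual.Supersingular.BlindLever
  Summit.BirchSwinnertonDyer.BirchSwinnertonDyer.Theorems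
  Summit.BirchSwinnertonDyer.BirchSwinnertonDyer.Theorems.Rank1ResidualX1Defs
  Summit.BirchSwinnertonDyer.BirchSwinnertonDyer.Theorems.AlignedTransportAtTwoSeed
  Summit.BirchSwinnertonDyer.BirchSwinnertonDyer.Theorems.AlignedTransportAtTwoCyclotomicLayerWeightEuler
  Summit.BirchSwinnertonDyer.BirchSwinnertonDyer.Theorems.AlignedTransportAtTwoTwistSaturation
  Summit.BirchSwinnertonDyer.BirchSwinnertonDyer.Theorems.AlignedTransportAtTwoTwinValueAlgebra
  Summit.BirchSwinnertonDyer.BirchSwinnertonDyer.Theorems.AlignedTransportAtTwoTwinValue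
  Summit.BirchSwinnertonDyer.BirchSwinnertonDyer.Theorems.AlignedTransportAtTwoTwinValueParity
  Summit.BirchSwinnertonDyer.BirchSwinnertonDyer.Theorems.AlignedTransportAtTwoTwinValueLambda
  Summit.BirchSwinnertonDyer.BirchSwinnertonDyer.Theorems.AlignedTransportAtTwoLayerValueDoublyDark
  Summit.BirchSwinnertonDyer.BirchSwinnertonDyer.Theorems.TwoAdicEulerCharKernel

/-! ## §1 The twin table at `λ = 2` -/

section Table

/-- **The common coefficient `q` is even**: for `F ≢ 0 (mod 2)`, `λ(F) = 2`, `F(0) ≠ 0`, `ι`-stable, with the data of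
`constantCoeff_and_evalAt_neg_two_eq` refined: `F(0) = q·v₀`, `F(−2) = (4 − q)·v₂`, `v₀, v₂` units AND `2 ∣ q` (`q` is a lower coefficient of a
distinguished polynomial). [cite: Washington1997, §7.1 (Weierstrass preparation, uniqueness)] -/
theorem constantCoeff_and_evalAt_neg_two_eq_of_even {F : IwasawaAlgebra 2} (hred : F.map (IsLocalRing.residue ℤ_[2]) ≠ 0) (hlam : lam F = 2)
    (h0 : PowerSeries.constantCoeff F ≠ 0) (hι : ∃ u : (IwasawaAlgebra 2)ˣ, invol 2 F = u * F) :
    ∃ (q : ℤ_[2]) (v₀ v₂ : ℤ_[2]ˣ), (2 : ℤ_[2]) ∣ q ∧ PowerSeries.constantCoeff F = q * v₀ ∧ evalAt (-2 : ℤ_[2]) F = (4 - q) * v₂ := by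
  set P : Polynomial ℤ_[2] := F.weierstrassDistinguished hred with hP
  set h : IwasawaAlgebra 2 := F.weierstrassUnit hred with hh
  have hPd : P.IsDistinguishedAt (IsLocalRing.maximalIdeal ℤ_[2]) := F.isDistinguishedAt_weierstrassDistinguished hred
  have hhU : IsUnit h := F.isUnit_weierstrassUnit hred
  have hfac : F = (P : IwasawaAlgebra 2) * h := F.eq_weierstrassDistinguished_mul_weierstrassUnit hred
  have hdeg : P.natDegree = 2 := by
    have hF1 : F = PowerSeries.C ((2 : ℤ_[2]) ^ 0) * F := by rw [pow_zero, map_one, one_mul]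
    have := lam_eq_natDegree_weierstrassDistinguished (p := 2) hF1 hred
    rw [← this, hlam]
  have hq : P.coeff 0 = P.coeff 1 := coeff_zero_eq_coeff_one_of_invol hred hlam h0 hι
  set q : ℤ_[2] := P.coeff 1 with hqdef
  have hqm : q ∈ IsLocalRing.maximalIdeal ℤ_[2] := hPd.mem (by rw [hdeg]; norm_num)
  have hq2 : (2 : ℤ_[2]) ∣ q := by
    rw [PadicInt.maximalIdeal_eq_span_p, Ideal.mem_span_singleton] at hqm
    simpa using hqm
  have hPeq : P = Polynomial.X ^ 2 + Polynomial.C q * Polynomial.X + Polynomial.C q := by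
    have h' := hPd.monic.as_sum
    rw [hdeg] at h'
    rw [h']
    simp [Finset.sum_range_succ, hq]
    ring
  have hn2 : ‖(-2 : ℤ_[2])‖ < 1 := norm_neg_two_lt_one
  have hh0 : IsUnit (PowerSeries.constantCoeff h) := PowerSeries.isUnit_iff_constantCoeff.mp hhU
  have hh2 : IsUnit (evalAt (-2 : ℤ_[2]) h) := by
    have := hhU.map (evalAtHom hn2); rwa [evalAtHom_apply] at this
  refine ⟨q, hh0.unit, hh2.unit, hq2, ?_, ?_⟩
  · rw [hfac, map_mul, Polynomial.constantCoeff_coe, hq, IsUnit.unit_spec]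
  · rw [hfac, evalAt_mul hn2, evalAt_coe, hPeq, IsUnit.unit_spec]
    simp only [Polynomial.eval_add, Polynomial.eval_mul, Polynomial.eval_pow, Polynomial.eval_X, Polynomial.eval_C]
    ring

/-- A unit of `ℤ₂` is `≡ 1 (mod 2)`. [folklore] -/
theorem two_dvd_one_sub_of_isUnit {t : ℤ_[2]} (ht : IsUnit t) : (2 : ℤ_[2]) ∣ 1 - t := by
  have hu : IsUnit (PadicInt.toZMod (p := 2) t) := ht.map _
  have h1 : PadicInt.toZMod (p := 2) t = 1 := by
    obtain ⟨w, hw⟩ := hu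
    have hall : ∀ w' : (ZMod 2)ˣ, w' = 1 := by decide
    rw [← hw, hall w, Units.val_one]
  have hmem : 1 - t ∈ RingHom.ker (PadicInt.toZMod (p := 2)) := by
    rw [RingHom.mem_ker, map_sub, map_one, h1, sub_self]
  rw [PadicInt.ker_toZMod, PadicInt.maximalIdeal_eq_span_p, Ideal.mem_span_singleton] at hmem
  simpa using hmem

/-- A non-unit of `ℤ₂` is even. [folklore] -/
theorem two_dvd_of_not_isUnit {t : ℤ_[2]} (ht : ¬ IsUnit t) : (2 : ℤ_[2]) ∣ t := by
  have htm : t ∈ IsLocalRing.maximalIdeal ℤ_[2] := (IsLocalRing.mem_maximalIdeal t).mpr (mem_nonunits_iff.mpr ht)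
  rw [PadicInt.maximalIdeal_eq_span_p, Ideal.mem_span_singleton] at htm
  simpa using htm

/-- ★★★ **THE TWIN TABLE AT `λ = 2`** (divisibility form). `F ∈ ℤ₂⟦T⟧`, `F ≠ 0`, `μ(F) = 0`, `λ(F) = 2`, `F(0) ≠ 0`, `ι`-stable: exactly one of
**`2 ∥ F(0) ∧ 2 ∥ F(−2)`**, **`4 ∥ F(0) ∧ 8 ∣ F(−2)`**, **`8 ∣ F(0) ∧ 4 ∥ F(−2)`** — i.e. `(ord₂F(0), ord₂F(−2)) ∈ {(1,1)} ∪ {2}×[3,∞] ∪ [3,∞)×{2}`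
(`F(−2) = 0` counted as order `∞`). [cite: Washington1997, §7.1 (Weierstrass preparation, uniqueness)] [cite: MazurTateTeitelbaum1986Invent, Ch. I §17] -/
theorem twin_table_of_lam_eq_two {F : IwasawaAlgebra 2} (hF : F ≠ 0) (hμ : mu F = 0) (hlam : lam F = 2)
    (h0 : PowerSeries.constantCoeff F ≠ 0) (hι : ∃ u : (IwasawaAlgebra 2)ˣ, invol 2 F = u * F) :
    ((2 : ℤ_[2]) ∣ PowerSeries.constantCoeff F ∧ ¬ (2 : ℤ_[2]) ^ 2 ∣ PowerSeries.constantCoeff F ∧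
        (2 : ℤ_[2]) ∣ evalAt (-2 : ℤ_[2]) F ∧ ¬ (2 : ℤ_[2]) ^ 2 ∣ evalAt (-2 : ℤ_[2]) F) ∨
      ((2 : ℤ_[2]) ^ 2 ∣ PowerSeries.constantCoeff F ∧ ¬ (2 : ℤ_[2]) ^ 3 ∣ PowerSeries.constantCoeff F ∧
        (2 : ℤ_[2]) ^ 3 ∣ evalAt (-2 : ℤ_[2]) F) ∨
      ((2 : ℤ_[2]) ^ 3 ∣ PowerSeries.constantCoeff F ∧ (2 : ℤ_[2]) ^ 2 ∣ evalAt (-2 : ℤ_[2]) F ∧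
        ¬ (2 : ℤ_[2]) ^ 3 ∣ evalAt (-2 : ℤ_[2]) F) := by
  have hred : F.map (IsLocalRing.residue ℤ_[2]) ≠ 0 := by
    have h := eq_C_pow_mu_mul_pfree F
    rw [hμ, pow_zero, map_one, one_mul] at h
    rw [h]; exact red_pfree_ne_zero hF
  obtain ⟨q, v₀, v₂, hq2, hF0, hF2⟩ := constantCoeff_and_evalAt_neg_two_eq_of_even hred hlam h0 hι
  obtain ⟨t, ht⟩ := hq2
  -- translate divisibilities of `F(0)`, `F(−2)` into divisibilities of `q`, `4 − q`
  have hd0 : ∀ c : ℤ_[2], c ∣ PowerSeries.constantCoeff F ↔ c ∣ q := fun c ↦ by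
    rw [hF0]; exact IsUnit.dvd_mul_right v₀.isUnit
  have hd2 : ∀ c : ℤ_[2], c ∣ evalAt (-2 : ℤ_[2]) F ↔ c ∣ 4 - q := fun c ↦ by
    rw [hF2]; exact IsUnit.dvd_mul_right v₂.isUnit
  simp only [hd0, hd2]
  by_cases htU : IsUnit t
  · -- `q = 2·unit`: `(1,1)`
    left
    obtain ⟨s, hs⟩ := two_dvd_one_sub_of_isUnit htU
    refine ⟨⟨t, ht⟩, fun h4 ↦ ?_, ⟨2 - t, by rw [ht]; ring⟩, fun h4 ↦ ?_⟩
    · rw [ht, pow_two] at h4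
      have : (2 : ℤ_[2]) ∣ t := (mul_dvd_mul_iff_left two_ne_zero).mp h4
      obtain ⟨r, hr⟩ := this
      have h1 : (1 : ℤ_[2]) = 2 * (s + r) := by linear_combination hs + hr
      exact absurd (isUnit_of_dvd_unit ⟨s + r, h1⟩ isUnit_one) (by
        rw [PadicInt.isUnit_iff]; have := PadicInt.norm_p (p := 2); norm_num at this ⊢; rw [this]; norm_num)
    · rw [ht, show (4 : ℤ_[2]) - 2 * t = 2 * (2 - t) by ring, pow_two] at h4
      have : (2 : ℤ_[2]) ∣ 2 - t := (mul_dvd_mul_iff_left two_ne_zero).mp h4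
      obtain ⟨r, hr⟩ := this
      -- `2 - t = 2r` and `1 - t = 2s` give `1 = 2(r - s)`
      have h1 : (1 : ℤ_[2]) = 2 * (r - s) := by linear_combination hr - hs
      exact absurd (isUnit_of_dvd_unit ⟨r - s, h1⟩ isUnit_one) (by
        rw [PadicInt.isUnit_iff]; have := PadicInt.norm_p (p := 2); norm_num at this ⊢; rw [this]; norm_num)
  · obtain ⟨t', ht'⟩ := two_dvd_of_not_isUnit htU
    -- `q = 4 t'`
    have hq4 : q = 2 ^ 2 * t' := by rw [ht, ht']; ring
    by_cases ht'U : IsUnit t'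
    · -- `(2, ≥ 3)`
      right; left
      obtain ⟨s, hs⟩ := two_dvd_one_sub_of_isUnit ht'U
      refine ⟨⟨t', hq4⟩, fun h8 ↦ ?_, ⟨s, ?_⟩⟩
      · rw [hq4, pow_succ, mul_comm ((2 : ℤ_[2]) ^ 2)] at h8
        have : (2 : ℤ_[2]) ∣ t' := by
          have h8' : (2 : ℤ_[2]) ^ 2 * 2 ∣ (2 : ℤ_[2]) ^ 2 * t' := by rwa [mul_comm] at h8
          exact (mul_dvd_mul_iff_left (pow_ne_zero 2 two_ne_zero)).mp h8'
        obtain ⟨r, hr⟩ := this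
        have h1 : (1 : ℤ_[2]) = 2 * (s + r) := by linear_combination hs + hr
        exact absurd (isUnit_of_dvd_unit ⟨s + r, h1⟩ isUnit_one) (by
          rw [PadicInt.isUnit_iff]; have := PadicInt.norm_p (p := 2); norm_num at this ⊢; rw [this]; norm_num)
      · rw [hq4, show (4 : ℤ_[2]) - 2 ^ 2 * t' = 2 ^ 2 * (1 - t') by ring, hs]; ring
    · -- `8 ∣ q`: `(≥ 3, 2)`
      right; right
      obtain ⟨t'', ht''⟩ := two_dvd_of_not_isUnit ht'U
      have hq8 : q = 2 ^ 3 * t'' := by rw [hq4, ht'']; ring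
      refine ⟨⟨t'', hq8⟩, ⟨1 - 2 * t'', by rw [hq8]; ring⟩, fun h8 ↦ ?_⟩
      rw [hq8, show (4 : ℤ_[2]) - 2 ^ 3 * t'' = 2 ^ 2 * (1 - 2 * t'') by ring, pow_succ (2 : ℤ_[2]) 2] at h8
      have : (2 : ℤ_[2]) ∣ 1 - 2 * t'' := (mul_dvd_mul_iff_left (pow_ne_zero 2 two_ne_zero)).mp h8
      obtain ⟨r, hr⟩ := this
      have h1 : (1 : ℤ_[2]) = 2 * (r + t'') := by linear_combination hr
      exact absurd (isUnit_of_dvd_unit ⟨r + t'', h1⟩ isUnit_one) (by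
        rw [PadicInt.isUnit_iff]; have := PadicInt.norm_p (p := 2); norm_num at this ⊢; rw [this]; norm_num)

/-- ★★ **`ord₂ F(0) ≥ 3 ⟹ ord₂ F(−2) = 2`** for `ι`-stable `F` with `μ = 0`, `λ = 2` (third row of the table).
[cite: Washington1997, §7.1 (Weierstrass preparation, uniqueness)] -/
theorem valuation_evalAt_eq_two_of_three_le {F : IwasawaAlgebra 2} (hF : F ≠ 0) (hμ : mu F = 0) (hlam : lam F = 2)
    (hι : ∃ u : (IwasawaAlgebra 2)ˣ, invol 2 F = u * F) (hc0 : PowerSeries.constantCoeff F ≠ 0) (h2 : evalAt (-2 : ℤ_[2]) F ≠ 0)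
    (ha : 3 ≤ (PowerSeries.constantCoeff F).valuation) : (evalAt (-2 : ℤ_[2]) F).valuation = 2 := by
  have h8 : (2 : ℤ_[2]) ^ 3 ∣ PowerSeries.constantCoeff F := (two_pow_dvd_iff_le_valuation hc0 3).mpr ha
  rcases twin_table_of_lam_eq_two hF hμ hlam hc0 hι with ⟨-, h4, -, -⟩ | ⟨-, h8', -⟩ | ⟨-, hb4, hb8⟩
  · exact absurd (dvd_trans (pow_dvd_pow 2 (by norm_num : 2 ≤ 3)) h8) h4
  · exact absurd h8 h8'
  · have hge := (two_pow_dvd_iff_le_valuation h2 2).mp hb4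
    have hlt : ¬ 3 ≤ (evalAt (-2 : ℤ_[2]) F).valuation := fun h ↦ hb8 ((two_pow_dvd_iff_le_valuation h2 3).mpr h)
    omega

/-- ★★★ **WEIGHT `≥ 3`: `(μ, λ) = (0, 2) ⟺ twin value `= 2`**, at the Λ-level. `F ∈ ℤ₂⟦T⟧`, `F ≠ 0`, `ι`-stable, `F(0) ≠ 0 ≠ F(−2)`, `ord₂ F(0) ≥ 3`:
**`μ(F) = 0 ∧ λ(F) = 2 ⟺ ord₂ F(−2) = 2`** (⟸: g49's `lam_eq_two_of_twinValue`; ⟹: the table). [cite: GreenbergLNM1716, Thm. 1.14 (p. 68), §5 p. 181]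
[cite: Washington1997, §7.1 (Weierstrass preparation, uniqueness)] -/
theorem mu_eq_zero_and_lam_eq_two_iff_twin_eq_two {F : IwasawaAlgebra 2} (hF : F ≠ 0)
    (hι : ∃ u : (IwasawaAlgebra 2)ˣ, invol 2 F = u * F) (hc0 : PowerSeries.constantCoeff F ≠ 0)
    (h2 : evalAt (-2 : ℤ_[2]) F ≠ 0) (ha : 3 ≤ (PowerSeries.constantCoeff F).valuation) :
    (mu F = 0 ∧ lam F = 2) ↔ (evalAt (-2 : ℤ_[2]) F).valuation = 2 :=
  ⟨fun h ↦ valuation_evalAt_eq_two_of_three_le hF h.1 h.2 hι hc0 h2 ha,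
    fun hb ↦ lam_eq_two_of_twinValue hF hι hc0 h2 (Or.inr hb) (by omega)⟩

end Table

/-! ## §2 C2's datum: the twin-two door is exact on the weight-`≥ 3` cell -/

section Datum

variable (κ : ZpExtension ℚ 2) (hκ : κ.IsCyclotomic) {γ : Field.absoluteGaloisGroup ℚ} (hγ : κ.IsTopGenerator γ)
  (hγ' : IsCyclotomicVariable 2 γ) (W : WeierstrassCurve ℚ) [W.IsElliptic] [W.IsGloballyMinimal]

include hκ hγ hγ' in
/-- ★★★ **ON THE WEIGHT-`≥ 3` CELL THE TWIN VALUE DECIDES `(μ(X), λ(X)) = (0, 2)` EXACTLY.** `W/ℚ` globally minimal, good ordinary at `2`,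
`Sel_{2^∞}(W/ℚ)` finite, normalised datum, dual datum `D`, generator `f_X` with `f_X(−2) ≠ 0`, Euler weight `w = ord₂ ∏c_ℓ + 2e + s − 2t ≥ 3`
(e.g. `a₂ = −1`, or `Ш(W)[2] = (ℤ/2)²`: `w = 4`); PRINT `h114`. Then **`μ(X(W/ℚ_∞)) = 0 ∧ λ(X(W/ℚ_∞)) = 2 ⟺ ord₂ f_X(−2) = 2`** — g49's
twin-two door is exactly the `(0, 2)` locus of the weight-`4` habitat. [cite: GreenbergLNM1716, Thm. 1.14 (p. 68), Thm. 4.1 (p. 102)]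
[cite: MazurTateTeitelbaum1986Invent, Ch. I §17] -/
theorem mu_eq_zero_and_lambda_eq_two_iff_twin_eq_two (h114 : Greenberg1999_thm114_charIdeal_iota_invariant) (hord : IsOrdinaryAt W 2)
    (D : W.SelmerDualData κ γ) (hfin : Finite (W.selmerGroupPInfty 2)) {t e s : ℕ}
    (ht : Nat.card (AddCommGroup.primaryComponent W.toAffine.Point 2) = 2 ^ t)
    (he : Nat.card (AddCommGroup.primaryComponent ((integralModelInt W).map (Int.castRingHom (ZMod 2))).toAffine.Point 2) = 2 ^ e)
    (hs : Nat.card (W.selmerGroupPInfty 2) = 2 ^ s) (hw : 3 ≤ padicValNat 2 W.tamagawaProduct + 2 * e + s - 2 * t)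
    {fX : IwasawaAlgebra 2} (hchar : D.charIdeal = Ideal.span {fX}) (h2 : evalAt (-2 : ℤ_[2]) fX ≠ 0) :
    (D.mu = 0 ∧ D.lambda = 2) ↔ (evalAt (-2 : ℤ_[2]) fX).valuation = 2 := by
  haveI : Module.Finite (IwasawaAlgebra 2) D.X := D.module_finite_holds hγ
  have hD : D.IsTorsion := isTorsion_of_finite κ hκ hγ W hord D hfin
  obtain ⟨-, hnorm⟩ := norm_constantCoeff_charGen_eq_of_thm41 W thm41_charValue_rankZero_anyPrime_holds
    ((isOrdinaryAt_iff W 2).mp hord).1 ((isOrdinaryAt_iff W 2).mp hord).2 hκ hγ hγ' D hD hchar hfin ht he hs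
  obtain ⟨hc0, hval⟩ := valuation_eq_of_norm_eq_two_inv_pow hnorm
  have hfXne : fX ≠ 0 := fun h0 ↦ hc0 (by rw [h0, map_zero])
  have hι := iotaStable_charGen_of_thm114 h114 W hord hκ hγ D hD hchar
  have hmufX : mu fX = D.mu := mu_generator_eq_muInvariant D.X hD hfXne hchar
  have hlamfX : lam fX = D.lambda := lam_generator_eq_lambdaInvariant D.X hD hfXne hchar
  rw [← hmufX, ← hlamfX]
  exact mu_eq_zero_and_lam_eq_two_iff_twin_eq_two hfXne hι hc0 h2 (by rw [hval]; exact hw)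

end Datum

end Summit.BirchSwinnertonDyer.BirchSwinnertonDyer.Theorems.AlignedTransportAtTwoLayerValueTwinTable

end
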